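import Summits.CriticalPhenomena.PercolationContinuityZ3.Theorems.FK.Transplant.KNFreeStepsSetting
import HarnessLib

/-!
# FK-continuity transplant, FT-06a: the FK examination as an adaptive probe and the FK exploration scheme
# (`succFK`, `probeFK`, `schemeFK`), with the bridge `{¬ succFK} ⊆ ⋃_x badFK`

Cell `fk-continuity` (bschramm), FRONTIER TRANSPLANT sub-cell, registry row FT-06a (`KNFreeScheme`), BINDER-OWNERS
row 7 file list; support file (`--supports stmt-CriticalPhenomena-4575`); builds on p205010 (kernel theorem,
internal audit signed; external expert review pending). HONEST FRAMING: the transplant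
`ufsc0_of_freeBoundaryHypothesis_r0` this file serves is CONDITIONAL on the free-boundary penetration hypothesis FH
(open at the same `p` for `q > 1`; ⇔ GRC Conj. (5.103) via the referee's calibration K1; barrier note
`Literature.Barriers.CriticalPhenomena.SamePFreeBoundaryCriteria`); it is a typed reduction, not a proof of FK
continuity. THIS file contains only definitions and their law-free locality lemmas: no named facts, no sorries,
standard axioms; `FH` does not occur in it.

## What is here

Kozma–Nitzan's examination of `v` from `w` (arXiv:2401.12397 §4 p. 27) computes the levels `j_x` from the observed
configuration through the goodness predicate (30); FT-01 (`FreeBoundaryHypotheses.lean`) typed the FK goodness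
`condFK S q` (minimal law `P^x = fkLaw (Sx) (Wt) q`) and the bad event `badFK S q`. This file completes the FK
twin of `KozmaNitzanScheme.lean` ll. 803–1025 with `condFK` in place of `cond` (proofs verbatim):

* `jOfFK`, `newRegionFK`, `revealOfFK`, `succFK` and their locality (`jOfFK_lt`, `…_subset_…`,
  `jOfFK_congr`, `revealOfFK_congr`, `succFK_congr`);
* `probeFK S q h e : AProbe (Site d)` — the FK examination as an adaptive probe; `succFK_read_iff`;
* `exists_forall_not_condFK_of_not_succFK` — **the bridge**: a failed FK examination has an onward direction that is
  good at no level, i.e. `{ω | ¬ succFK (read ω)} ⊆ ⋃_{x onward} badFK` (how C3b / FT-07 sums UFSC0's per-direction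
  bounds, KN (33));
* `nextProbeFK`, `schemeFK S q : HSiteScheme (Site d)` — the FK exploration process (probes only after `ValidFK`
  histories), `nextProbeFK_eq_some`, `nextProbeFK_of_validFK`.

## References

* G. Kozma, S. Nitzan, arXiv:2401.12397 (2024), §4 pp. 25–28. [KozmaNitzan2024]
-/

noncomputable section

open MeasureTheory
open scoped Classical

namespace Summit.CriticalPhenomena.PercolationContinuityZ3.Theorems.FK

open Literature.Probability.Percolation Literature.Probability.LatticeModels
open Literature.Probability.Percolation.KozmaNitzan Literature.Probability.Percolation.GadgetSystem

variable {d : ℕ} (S : KSch d) (q : ℝ)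

/-- `j_x` (FK): the first good level under the minimal law, or `K - 1`. Twin of tree `KSch.jOf`.
[cite: KozmaNitzan2024, §4 p. 27 (j_x)] -/
def jOfFK (h : ProbeHistory (Site d)) (e : Site 2 × MDir) (du : MDir) (o : Finset (Sym2 (Site d))) : ℕ :=
  jIdx S.C.K fun j => condFK S q h e du j o

/-- The region revealed by the FK examination, given the observation. Twin of tree `KSch.newRegion`.
[cite: KozmaNitzan2024, §4 p. 27 (E_{i+1})] -/
def newRegionFK (h : ProbeHistory (Site d)) (e : Site 2 × MDir) (o : Finset (Sym2 (Site d))) : Finset (Site d) :=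
  S.C.Ewv e.1 e.2 ∪ (S.onward h (tgt e)).biUnion fun du => S.C.Stub (tgt e) du (jOfFK S q h e du o)

/-- The revealed edges of the FK examination, given the observation. Twin of tree `KSch.revealOf`.
[cite: KozmaNitzan2024, §4 p. 27 (E_{i+1})] -/
def revealOfFK (h : ProbeHistory (Site d)) (e : Site 2 × MDir) (o : Finset (Sym2 (Site d))) :
    Finset (Sym2 (Site d)) :=
  edgesIn (zdGraph d) (S.V h ∪ newRegionFK S q h e o) \ S.F h

/-- **Success (FK)**: all connections to all onward `x` are good under their minimal laws. Twin of tree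
`KSch.succ`. [cite: KozmaNitzan2024, §4 p. 27] -/
def succFK (h : ProbeHistory (Site d)) (e : Site 2 × MDir) (o : Finset (Sym2 (Site d))) : Prop :=
  ∀ du ∈ S.onward h (tgt e), condFK S q h e du (jOfFK S q h e du o) o

/-! ### Locality (proofs as in `KozmaNitzanScheme.lean`) -/

/-- `j_x < K`. [folklore] -/
theorem jOfFK_lt (h : ProbeHistory (Site d)) (e : Site 2 × MDir) (du : MDir) (o : Finset (Sym2 (Site d))) :
    jOfFK S q h e du o < S.C.K :=
  jIdx_lt (by have := S.C.hK; omega) _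

/-- The new region lies in the envelope region. [folklore] -/
theorem newRegionFK_subset_envRegion (h : ProbeHistory (Site d)) (e : Site 2 × MDir) (o : Finset (Sym2 (Site d))) :
    newRegionFK S q h e o ⊆ S.envRegion h e := by
  intro y hy
  rcases Finset.mem_union.1 hy with hy | hy
  · exact Finset.mem_union_left _ hy
  · refine Finset.mem_union_right _ ?_
    rw [Finset.mem_biUnion] at hy ⊢
    obtain ⟨du, hdu, hy⟩ := hy
    exact ⟨du, hdu, S.C.stub_mono _ _ (by have := jOfFK_lt S q h e du o; omega) hy⟩

/-- The revealed edges lie in the envelope. [folklore] -/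
theorem revealOfFK_subset_env (h : ProbeHistory (Site d)) (e : Site 2 × MDir) (o : Finset (Sym2 (Site d))) :
    revealOfFK S q h e o ⊆ S.env h e := by
  refine Finset.sdiff_subset_sdiff ?_ le_rfl
  intro x hx
  rw [mem_edgesIn_iff] at hx ⊢
  refine ⟨hx.1, fun y hy => ?_⟩
  rcases Finset.mem_union.1 (hx.2 y hy) with h' | h'
  · exact Finset.mem_union_left _ h'
  · exact Finset.mem_union_right _ (newRegionFK_subset_envRegion S q h e o h')

/-- The new conditioned edges at level `j ≤ j_x` of an onward direction are revealed. [folklore] -/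
theorem Fj_sdiff_subset_revealOfFK {h : ProbeHistory (Site d)} {e : Site 2 × MDir} {du : MDir}
    (hdu : du ∈ S.onward h (tgt e)) {o : Finset (Sym2 (Site d))} {j : ℕ} (hj : j ≤ jOfFK S q h e du o) :
    S.Fj h e du j \ S.F h ⊆ revealOfFK S q h e o := by
  refine Finset.sdiff_subset_sdiff ?_ le_rfl
  intro x hx
  rw [KSch.Fj, mem_edgesIn_iff] at hx
  rw [mem_edgesIn_iff]
  refine ⟨hx.1, fun y hy => ?_⟩
  rcases Finset.mem_union.1 (hx.2 y hy) with h' | h'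
  · rcases Finset.mem_union.1 h' with h'' | h''
    · exact Finset.mem_union_left _ h''
    · exact Finset.mem_union_right _ (Finset.mem_union_left _ h'')
  · refine Finset.mem_union_right _ (Finset.mem_union_right _ ?_)
    exact Finset.mem_biUnion.2 ⟨du, hdu, S.C.stub_mono _ _ hj h'⟩

variable {S q}

/-- **Locality of `j_x` (FK).** [folklore] -/
theorem jOfFK_congr {h : ProbeHistory (Site d)} {e : Site 2 × MDir} {du : MDir} (hdu : du ∈ S.onward h (tgt e))
    {o o' : Finset (Sym2 (Site d))} (hoo' : ∀ x ∈ revealOfFK S q h e o, x ∈ o ↔ x ∈ o') :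
    jOfFK S q h e du o' = jOfFK S q h e du o ∧
      (condFK S q h e du (jOfFK S q h e du o) o' ↔ condFK S q h e du (jOfFK S q h e du o) o) := by
  have key : ∀ j ≤ jOfFK S q h e du o, (condFK S q h e du j o ↔ condFK S q h e du j o') := fun j hj =>
    condFK_congr h e du j fun x hx => hoo' x (Fj_sdiff_subset_revealOfFK S q hdu hj hx)
  exact ⟨jIdx_congr key, (key _ le_rfl).symm⟩

/-- **Locality of the revealed set (FK).** [folklore] -/
theorem revealOfFK_congr {h : ProbeHistory (Site d)} {e : Site 2 × MDir} {o o' : Finset (Sym2 (Site d))}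
    (hoo' : ∀ x ∈ revealOfFK S q h e o, x ∈ o ↔ x ∈ o') : revealOfFK S q h e o' = revealOfFK S q h e o := by
  unfold revealOfFK newRegionFK
  have : ∀ du ∈ S.onward h (tgt e), jOfFK S q h e du o' = jOfFK S q h e du o := fun du hdu => (jOfFK_congr hdu hoo').1
  rw [Finset.biUnion_congr rfl fun du hdu => by rw [this du hdu]]

/-- **Locality of success (FK).** [folklore] -/
theorem succFK_congr {h : ProbeHistory (Site d)} {e : Site 2 × MDir} {o o' : Finset (Sym2 (Site d))}
    (hoo' : ∀ x ∈ revealOfFK S q h e o, x ∈ o ↔ x ∈ o') : succFK S q h e o' ↔ succFK S q h e o := by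
  unfold succFK
  refine forall₂_congr fun du hdu => ?_
  obtain ⟨h1, h2⟩ := jOfFK_congr hdu hoo'
  rw [h1, h2]

variable (S q)

/-! ### The probe, the bridge to `badFK`, the scheme -/

/-- **The FK examination of `v = tgt e` from `e.1` as an adaptive probe** (reveals `E_{w,v}` and the stubs
`H^{j_x}_{v,x}`, the `j_x` computed under the minimal laws). Twin of tree `KSch.probe`.
[cite: KozmaNitzan2024, §4 p. 27] -/
def probeFK (h : ProbeHistory (Site d)) (e : Site 2 × MDir) : AProbe (Site d) where
  env := S.env h e
  reveal := fun ω => revealOfFK S q h e (obs ω (S.env h e))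
  reveal_subset := fun ω => revealOfFK_subset_env S q h e _
  reveal_local := by
    intro ω ω' hag
    refine revealOfFK_congr fun x hx => ?_
    have hxe : x ∈ S.env h e := revealOfFK_subset_env S q h e _ hx
    simp only [mem_obs_iff, hxe, true_and]
    exact hag x hx

/-- Success read off the probe's observation is success read off the envelope's. [folklore] -/
theorem succFK_read_iff (h : ProbeHistory (Site d)) (e : Site 2 × MDir) (ω : BondConfig (Site d)) :
    succFK S q h e ((probeFK S q h e).read ω) ↔ succFK S q h e (obs ω (S.env h e)) := by
  refine succFK_congr fun x hx => ?_
  have hxe : x ∈ S.env h e := revealOfFK_subset_env S q h e _ hx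
  simp only [AProbe.read, probeFK, mem_obs_iff, hxe, hx, true_and]

/-- **The bridge to `badFK`**: a failed FK examination has an onward direction that is good at no level,
`{ω | ¬ succFK (read ω)} ⊆ ⋃_{x onward} badFK` (so the history-conditional failure probability is at most the sum
of `≤ 4` per-direction bounds, KN (33)). Twin of tree `KSch.not_succ_subset`. [cite: KozmaNitzan2024, §4 p. 27 (j_x), p. 31] -/
theorem not_succFK_subset (h : ProbeHistory (Site d)) (e : Site 2 × MDir) :
    {ω | ¬succFK S q h e ((probeFK S q h e).read ω)} ⊆ ⋃ du ∈ S.onward h (tgt e), badFK S q h e du := by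
  intro ω hω
  simp only [Set.mem_setOf_eq, succFK_read_iff] at hω
  simp only [succFK] at hω
  push Not at hω
  obtain ⟨du, hdu, hc⟩ := hω
  simp only [Set.mem_iUnion, exists_prop]
  exact ⟨du, hdu, forall_not_of_not_jIdx (P := fun j => condFK S q h e du j (obs ω (S.env h e)))
    (by have := S.C.hK; omega) hc⟩

/-- The next probe of the FK scheme: examine the chosen candidate, but only after an FK-valid history.
Twin of tree `KSch.nextProbe`. [cite: KozmaNitzan2024, §4 p. 27] -/
def nextProbeFK (h : ProbeHistory (Site d)) : Option (AProbe (Site d)) :=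
  match (HSiteScheme.mstOf (succFK S q) h).choice with
  | none => none
  | some e => if ValidFK S q h e then some (probeFK S q h e) else none

/-- **The FK exploration process** as a history-driven site scheme. Twin of tree `KSch.scheme`.
[cite: KozmaNitzan2024, §4 pp. 26–27] -/
def schemeFK : HSiteScheme (Site d) := ⟨⟨nextProbeFK S q⟩, S.U₀, succFK S q⟩

variable {S q}

/-- If a probe is made, the history is FK-valid for the chosen edge and the probe is the FK examination. [folklore] -/
theorem nextProbeFK_eq_some {h : ProbeHistory (Site d)} {P : AProbe (Site d)} (hP : nextProbeFK S q h = some P) :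
    ∃ e, (HSiteScheme.mstOf (succFK S q) h).choice = some e ∧ ValidFK S q h e ∧ P = probeFK S q h e := by
  unfold nextProbeFK at hP
  cases hc : (HSiteScheme.mstOf (succFK S q) h).choice with
  | none => rw [hc] at hP; simp at hP
  | some e =>
    rw [hc] at hP
    simp only at hP
    split_ifs at hP with hV
    rw [Option.some.injEq] at hP
    exact ⟨e, rfl, hV, hP.symm⟩

/-- Conversely an FK-valid history with a candidate is probed. [folklore] -/
theorem nextProbeFK_of_validFK {h : ProbeHistory (Site d)} {e : Site 2 × MDir}
    (hc : (HSiteScheme.mstOf (succFK S q) h).choice = some e) (hV : ValidFK S q h e) :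
    nextProbeFK S q h = some (probeFK S q h e) := by
  unfold nextProbeFK; rw [hc]; simp only; rw [if_pos hV]

end Summit.CriticalPhenomena.PercolationContinuityZ3.Theorems.FK

end
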